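import Summits.Schanuel.Schanuel.Theorems.ZilberEacDirectionalDominancePuncture
import HarnessLib

/-!
# THEOREM K′: directional dominance for a SUPER-POLYNOMIALLY LARGE power coordinate along rays

Zilber's Exponential-Algebraic Closedness, case ladder (host summit Schanuel, cell `pub-schanuel`,
seat 2, gen 11).  The cell's ray engines kill relations `H(w, x) = 0` along `x_m = m v + o(m)` when
the extra coordinate `w` has irrational POWER growth (THEOREM J, `ZilberEacDirectionalDominance`) or
SUPER-POLYNOMIAL DECAY (THEOREM J′, `ZilberEacDirectionalDominancePuncture`); the explosion engine
THEOREM K (`ZilberEacExplosionDominance`) needs the solutions super-polynomially close to LINES.  The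
missing third ray format — `w_m` of SUPER-POLYNOMIAL GROWTH, `log ‖w_m‖ / log m → +∞`, along
`x_m = m v + o(m)` — is supplied here; it is the mirror image of J′ (dominant index: HIGHEST power of
`W`, then highest degree in `X`):

* `exists_mem_directionalComponents_ne_zero` — the direction-selection step shared by J/J′/K′;
* THEOREM K₀′ `eventually_eval_cons_ne_zero_of_directional_explosion`;
* THEOREM K′ `eq_zero_of_directional_explosion`, the `∃`-form
  `exists_eventually_eval_cons_ne_zero_of_directional_explosion`, and the density form
  `unprojectedDense_of_directional_explosion`.

Uses (this generation): pure targets over graph bases with an explosion ray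
(`ZilberEacPureTargetsDensity`) and the genericity of the limit family in the invariant-direction
regime (`ZilberEacInvariantDirectionDensity`).

HONEST FRAMING: an elimination lemma (elementary asymptotics); `EC(3,2)` OPEN; nothing here bears on
Schanuel's conjecture (EAC ⇏ SC).
-/

noncomputable section

open MvPolynomial Filter Topology Finset Complex
open Literature.NumberTheory.Transcendental Literature.ModelTheory.Zilber

set_option linter.dupNamespace false

namespace Summit.Schanuel.Schanuel.Theorems

/-! ## Part A. Selecting a direction off all directional components -/

section Selection

variable {t : ℕ}

/-- **Direction selection.**  If no nonzero polynomial vanishes identically on `Q`, then for every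
`H ∈ ℂ[W, X₁..X_t]` some `v ∈ Q` is a non-zero of EVERY nonzero directional component
`homogeneousComponent N (coeff_{W^c} H)` (apply the hypothesis to their product). [folklore] -/
theorem exists_mem_directionalComponents_ne_zero (H : MvPolynomial (Fin (t + 1)) ℂ)
    {Q : Set (Fin t → ℂ)} (hQ : ∀ G : MvPolynomial (Fin t) ℂ, G ≠ 0 → ∃ v ∈ Q, eval v G ≠ 0) :
    ∃ v ∈ Q, ∀ c N, homogeneousComponent N ((finSuccEquiv ℂ t H).coeff c) ≠ 0 →
      eval v (homogeneousComponent N ((finSuccEquiv ℂ t H).coeff c)) ≠ 0 := by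
  classical
  set P := finSuccEquiv ℂ t H with hPdef
  set D : ℕ := P.natDegree + 1 with hDdef
  set Nmax : ℕ := P.support.sup (fun c => (P.coeff c).totalDegree) + 1 with hNdef
  have hN : ∀ c, (P.coeff c).totalDegree < Nmax := by
    intro c
    by_cases hc : c ∈ P.support
    · exact Nat.lt_succ_of_le (Finset.le_sup (f := fun c => (P.coeff c).totalDegree) hc)
    · rw [Polynomial.notMem_support_iff.1 hc, totalDegree_zero]
      exact Nat.succ_pos _
  set R : Finset (ℕ × ℕ) := range Nmax ×ˢ range D with hR
  set G : ℕ × ℕ → MvPolynomial (Fin t) ℂ := fun p => homogeneousComponent p.1 (P.coeff p.2) with hGdef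
  set S : Finset (ℕ × ℕ) := R.filter fun p => G p ≠ 0 with hSdef
  have hprod : ∏ p ∈ S, G p ≠ 0 := Finset.prod_ne_zero_iff.2 fun p hp => (Finset.mem_filter.1 hp).2
  obtain ⟨v, hvQ, hvprod⟩ := hQ _ hprod
  rw [map_prod] at hvprod
  refine ⟨v, hvQ, fun c N hcN => ?_⟩
  have hmem : (N, c) ∈ S := by
    refine Finset.mem_filter.2 ⟨?_, hcN⟩
    rw [hR, Finset.mem_product, Finset.mem_range, Finset.mem_range]
    exact ⟨(le_totalDegree_of_homogeneousComponent_coeff_ne_zero H hcN).trans_lt (hN c),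
      Nat.lt_succ_of_le (le_natDegree_of_homogeneousComponent_coeff_ne_zero H hcN)⟩
  exact (Finset.prod_ne_zero_iff.1 hvprod) (N, c) hmem

end Selection

/-! ## Part B. THEOREM K₀′ / K′: super-polynomially large power coordinate -/

section Explosion

variable {t : ℕ}

/-- **THEOREM K₀′ (one direction, explosion along a ray).**  `H ∈ ℂ[W, X₁..X_t]` nonzero, every
nonzero directional component non-vanishing at `v`; `x_m = m v + o(m)`; `w_m ≠ 0` with
`log ‖w_m‖ / log m → +∞`.  Then `H(w_m, x_m) ≠ 0` for all large `m` (dominant term: the highest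
power of `W` present, and within it the highest degree in `X`). (new) -/
theorem eventually_eval_cons_ne_zero_of_directional_explosion (H : MvPolynomial (Fin (t + 1)) ℂ)
    (hH : H ≠ 0) {v : Fin t → ℂ}
    (hv : ∀ c N, homogeneousComponent N ((finSuccEquiv ℂ t H).coeff c) ≠ 0 →
      eval v (homogeneousComponent N ((finSuccEquiv ℂ t H).coeff c)) ≠ 0)
    {x : ℕ → Fin t → ℂ} {w : ℕ → ℂ}
    (hx : ∀ ρ : ℝ, 0 < ρ → ∀ᶠ m : ℕ in atTop, ‖x m - fun i => (m : ℂ) * v i‖ ≤ ρ * m)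
    (hw0 : ∀ᶠ m : ℕ in atTop, w m ≠ 0)
    (hgrow : Tendsto (fun m : ℕ => Real.log ‖w m‖ / Real.log m) atTop atTop) :
    ∀ᶠ m : ℕ in atTop, eval (Fin.cons (w m) (x m) : Fin (t + 1) → ℂ) H ≠ 0 := by
  classical
  set P := finSuccEquiv ℂ t H with hPdef
  have hP0 : P ≠ 0 := fun h => hH ((finSuccEquiv ℂ t).injective (by rw [← hPdef, h, map_zero]))
  set D : ℕ := P.natDegree + 1 with hDdef
  set Nmax : ℕ := P.support.sup (fun c => (P.coeff c).totalDegree) + 1 with hNdef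
  have hN : ∀ c, (P.coeff c).totalDegree < Nmax := by
    intro c
    by_cases hc : c ∈ P.support
    · exact Nat.lt_succ_of_le (Finset.le_sup (f := fun c => (P.coeff c).totalDegree) hc)
    · rw [Polynomial.notMem_support_iff.1 hc, totalDegree_zero]
      exact Nat.succ_pos _
  set R : Finset (ℕ × ℕ) := range Nmax ×ˢ range D with hR
  set G : ℕ × ℕ → MvPolynomial (Fin t) ℂ := fun p => homogeneousComponent p.1 (P.coeff p.2) with hGdef
  set S : Finset (ℕ × ℕ) := R.filter fun p => G p ≠ 0 with hSdef
  have hSR : ∀ p ∈ S, p ∈ R ∧ G p ≠ 0 := fun p hp => Finset.mem_filter.1 hp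
  have hS : S.Nonempty := by
    have hlc : P.coeff P.natDegree ≠ 0 := Polynomial.leadingCoeff_ne_zero.2 hP0
    have hsum := sum_homogeneousComponent_of_lt (P.coeff P.natDegree) (hN P.natDegree)
    obtain ⟨N, hNm, hNz⟩ : ∃ N ∈ range Nmax, homogeneousComponent N (P.coeff P.natDegree) ≠ 0 := by
      by_contra hcon
      push Not at hcon
      exact hlc (by rw [← hsum]; exact Finset.sum_eq_zero hcon)
    refine ⟨(N, P.natDegree), Finset.mem_filter.2 ⟨?_, hNz⟩⟩
    rw [hR, Finset.mem_product]
    exact ⟨hNm, Finset.mem_range.2 (Nat.lt_succ_self _)⟩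
  -- the dominant index: MAXIMAL power of `W`, then maximal degree in `X`
  have hS2 : (S.image Prod.snd).Nonempty := hS.image _
  set c₀ : ℕ := (S.image Prod.snd).max' hS2 with hc₀
  have hc₀mem : c₀ ∈ S.image Prod.snd := Finset.max'_mem _ _
  set S₀ : Finset (ℕ × ℕ) := S.filter fun p => p.2 = c₀ with hS₀
  have hS₀ne : S₀.Nonempty := by
    obtain ⟨p, hp, hpc⟩ := Finset.mem_image.1 hc₀mem
    exact ⟨p, Finset.mem_filter.2 ⟨hp, hpc⟩⟩
  have hS1 : (S₀.image Prod.fst).Nonempty := hS₀ne.image _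
  set N₀ : ℕ := (S₀.image Prod.fst).max' hS1 with hN₀
  have hN₀mem : N₀ ∈ S₀.image Prod.fst := Finset.max'_mem _ _
  have hs₀ : (N₀, c₀) ∈ S := by
    obtain ⟨p, hp, hpN⟩ := Finset.mem_image.1 hN₀mem
    obtain ⟨hpS, hpc⟩ := Finset.mem_filter.1 hp
    have : p = (N₀, c₀) := Prod.ext hpN hpc
    rwa [this] at hpS
  have hcmax : ∀ p ∈ S, p.2 ≤ c₀ := fun p hp =>
    Finset.le_max' _ _ (Finset.mem_image.2 ⟨p, hp, rfl⟩)
  have hNmax : ∀ p ∈ S, p.2 = c₀ → p.1 ≤ N₀ := fun p hp hpc =>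
    Finset.le_max' _ _ (Finset.mem_image.2 ⟨p, Finset.mem_filter.2 ⟨hp, hpc⟩, rfl⟩)
  -- growth exponents
  set u : ℕ → ℝ := fun m => Real.log ‖w m‖ / Real.log m with hu
  set φ : ℕ × ℕ → ℕ → ℝ := fun p m => (p.1 : ℝ) * Real.log m + (p.2 : ℝ) * Real.log ‖w m‖ with hφ
  have hlogm : ∀ᶠ m : ℕ in atTop, 1 ≤ Real.log m :=
    (Real.tendsto_log_atTop.comp tendsto_natCast_atTop_atTop).eventually_ge_atTop 1
  have hφu : ∀ p : ℕ × ℕ, ∀ᶠ m : ℕ in atTop, φ p m - φ (N₀, c₀) m =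
      (((p.1 : ℝ) - N₀) - ((c₀ : ℝ) - p.2) * u m) * Real.log m := by
    intro p
    filter_upwards [hlogm] with m hm
    have hne : Real.log m ≠ 0 := by linarith
    simp only [hφ, hu]
    field_simp
    ring
  have hdom : ∀ p ∈ S, p ≠ (N₀, c₀) → Tendsto (fun m => φ p m - φ (N₀, c₀) m) atTop atBot := by
    intro p hp hne
    rcases (hcmax p hp).lt_or_eq with hlt | heq
    · -- lower power of `W`: the growth wins
      have hb : (0 : ℝ) < (c₀ : ℝ) - p.2 := by
        have : (p.2 : ℝ) < c₀ := by exact_mod_cast hlt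
        linarith
      exact (tendsto_sub_mul_mul_log_atBot hgrow _ hb).congr' ((hφu p).mono fun m hm => hm.symm)
    · -- same power, lower degree in `X`
      have hle := hNmax p hp heq
      have hlt : p.1 < N₀ := lt_of_le_of_ne hle fun h => hne (Prod.ext h heq)
      have hneg : (p.1 : ℝ) - N₀ < 0 := by
        have : (p.1 : ℝ) < N₀ := by exact_mod_cast hlt
        linarith
      have h1 : Tendsto (fun m : ℕ => ((p.1 : ℝ) - N₀) * Real.log m) atTop atBot :=
        (Real.tendsto_log_atTop.comp tendsto_natCast_atTop_atTop).const_mul_atTop_of_neg hneg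
      refine h1.congr' ((hφu p).mono fun m hm => ?_)
      show _ = φ p m - φ (N₀, c₀) m
      rw [hm, heq]
      simp
  -- log bounds for the `X`-parts
  have hterm : ∀ p ∈ S, ∃ E : ℝ, ∀ᶠ m : ℕ in atTop, eval (x m) (G p) ≠ 0 ∧
      |Real.log ‖eval (x m) (G p)‖ - p.1 * Real.log m| ≤ E := by
    intro p hp
    exact eventually_log_norm_eval_homogeneous (homogeneousComponent_isHomogeneous _ _)
      (hv p.2 p.1 (hSR p hp).2) hx
  choose! E hE using hterm
  set z : ℕ → ℕ × ℕ → ℂ := fun m p => eval (x m) (G p) * w m ^ p.2 with hz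
  set E' : ℝ := ∑ p ∈ S, |E p| with hE'
  have hallE : ∀ᶠ m : ℕ in atTop, ∀ p ∈ S, eval (x m) (G p) ≠ 0 ∧
      |Real.log ‖eval (x m) (G p)‖ - p.1 * Real.log m| ≤ E p :=
    (Filter.eventually_all_finset S).2 fun p hp => hE p hp
  have hbounds : ∀ᶠ m : ℕ in atTop, ∀ p ∈ S,
      Real.exp (φ p m - E') ≤ ‖z m p‖ ∧ ‖z m p‖ ≤ Real.exp (φ p m + E') := by
    filter_upwards [hallE, hw0] with m hm hwm p hp
    obtain ⟨hGne, hGlog⟩ := hm p hp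
    have hnorm : ‖z m p‖ = Real.exp (Real.log ‖eval (x m) (G p)‖ + p.2 * Real.log ‖w m‖) := by
      rw [Real.exp_add, Real.exp_nat_mul, Real.exp_log (norm_pos_iff.2 hGne),
        Real.exp_log (norm_pos_iff.2 hwm), hz]
      simp only [norm_mul, norm_pow]
    have hEp : |E p| ≤ E' := Finset.single_le_sum (f := fun p => |E p|) (fun _ _ => abs_nonneg _) hp
    have hdev : |Real.log ‖eval (x m) (G p)‖ + p.2 * Real.log ‖w m‖ - φ p m| ≤ E' := by
      have e : Real.log ‖eval (x m) (G p)‖ + p.2 * Real.log ‖w m‖ - φ p m =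
          Real.log ‖eval (x m) (G p)‖ - p.1 * Real.log m := by simp only [hφ]; ring
      rw [e]
      exact (hGlog.trans (le_abs_self _)).trans hEp
    rw [abs_le] at hdev
    rw [hnorm]
    exact ⟨Real.exp_le_exp.2 (by linarith [hdev.1]), Real.exp_le_exp.2 (by linarith [hdev.2])⟩
  have hne := eventually_sum_ne_zero_of_dominant S hs₀ φ hdom E' z hbounds
  filter_upwards [hne] with m hm
  have hSR' : ∑ p ∈ S, z m p = ∑ p ∈ R, z m p := by
    rw [hSdef]
    exact Finset.sum_filter_of_ne fun p _ hzp => by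
      intro hGp
      apply hzp
      simp only [hz, hGp, map_zero, zero_mul]
  rw [eval_cons_eq_sum H (Nat.lt_succ_self _) hN, ← hR]
  rwa [hSR'] at hm

/-- **THEOREM K′, `∃`-form.**  If no nonzero polynomial vanishes identically on the direction set
`Q` and every `v ∈ Q` carries sequences `x_m = m v + o(m)`, `w_m ≠ 0` with `log ‖w_m‖ / log m → +∞`,
then every nonzero `H` is non-zero at `(w_m, x_m)` for some `v ∈ Q` and all large `m`. (new) -/
theorem exists_eventually_eval_cons_ne_zero_of_directional_explosion
    (H : MvPolynomial (Fin (t + 1)) ℂ) (hH : H ≠ 0) {Q : Set (Fin t → ℂ)}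
    (hQ : ∀ G : MvPolynomial (Fin t) ℂ, G ≠ 0 → ∃ v ∈ Q, eval v G ≠ 0)
    (x : (Fin t → ℂ) → ℕ → Fin t → ℂ) (w : (Fin t → ℂ) → ℕ → ℂ)
    (hx : ∀ v ∈ Q, ∀ ρ : ℝ, 0 < ρ → ∀ᶠ m : ℕ in atTop, ‖x v m - fun i => (m : ℂ) * v i‖ ≤ ρ * m)
    (hw0 : ∀ v ∈ Q, ∀ᶠ m : ℕ in atTop, w v m ≠ 0)
    (hgrow : ∀ v ∈ Q, Tendsto (fun m : ℕ => Real.log ‖w v m‖ / Real.log m) atTop atTop) :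
    ∃ v ∈ Q, ∀ᶠ m : ℕ in atTop, eval (Fin.cons (w v m) (x v m) : Fin (t + 1) → ℂ) H ≠ 0 := by
  obtain ⟨v, hvQ, hv⟩ := exists_mem_directionalComponents_ne_zero H hQ
  exact ⟨v, hvQ, eventually_eval_cons_ne_zero_of_directional_explosion H hH hv (hx v hvQ) (hw0 v hvQ)
    (hgrow v hvQ)⟩

/-- **THEOREM K′ (all directions, explosion along rays).**  If for every direction `v` in a set `Q`
on which no nonzero polynomial vanishes identically there are sequences `x_m = m v + o(m)` and
`w_m ≠ 0` with `log ‖w_m‖ / log m → +∞` and `H(w_m, x_m) = 0` for all large `m`, then `H = 0`.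
(new) -/
theorem eq_zero_of_directional_explosion (H : MvPolynomial (Fin (t + 1)) ℂ) {Q : Set (Fin t → ℂ)}
    (hQ : ∀ G : MvPolynomial (Fin t) ℂ, G ≠ 0 → ∃ v ∈ Q, eval v G ≠ 0)
    (hseq : ∀ v ∈ Q, ∃ (x : ℕ → Fin t → ℂ) (w : ℕ → ℂ),
      (∀ ρ : ℝ, 0 < ρ → ∀ᶠ m : ℕ in atTop, ‖x m - fun i => (m : ℂ) * v i‖ ≤ ρ * m) ∧
      (∀ᶠ m : ℕ in atTop, w m ≠ 0) ∧
      Tendsto (fun m : ℕ => Real.log ‖w m‖ / Real.log m) atTop atTop ∧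
      ∀ᶠ m : ℕ in atTop, eval (Fin.cons (w m) (x m) : Fin (t + 1) → ℂ) H = 0) : H = 0 := by
  by_contra hH
  obtain ⟨v, hvQ, hv⟩ := exists_mem_directionalComponents_ne_zero H hQ
  obtain ⟨x, w, hx, hw0, hgrow, hzero⟩ := hseq v hvQ
  have hne := eventually_eval_cons_ne_zero_of_directional_explosion H hH hv hx hw0 hgrow
  obtain ⟨m, hm1, hm2⟩ := (hne.and hzero).exists
  exact hm1 hm2

end Explosion

/-! ## Part C. Density form -/

section Density

variable {n t : ℕ}

/-- **THEOREM K′ (density from directional explosion along rays).**  `S ⊆ ℂⁿ × ℂⁿ` irreducible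
closed of dimension `≤ t + 1`, coordinates `c₁..c_t` and `β`, `Q` a set of directions supporting no
nonzero polynomial.  If for every `v ∈ Q` there are points `p_m`, exponential points of `S` for
large `m`, with `‖(p_m(c_i))_i - m v‖ ≤ C log m`, `p_m(β) ≠ 0` and `log ‖p_m(β)‖ / log m → +∞`, then
`I(S ∩ Γ_exp) = I(S)`. (new) -/
theorem unprojectedDense_of_directional_explosion {S : Set (Fin n ⊕ Fin n → ℂ)}
    (hS : IsIrreducibleClosed ℂ S) (hdim : zariskiDim ℂ S ≤ ((t + 1 : ℕ) : WithBot ℕ∞))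
    (c : Fin t → Fin n ⊕ Fin n) (β : Fin n ⊕ Fin n)
    {Q : Set (Fin t → ℂ)} (hQ : ∀ G : MvPolynomial (Fin t) ℂ, G ≠ 0 → ∃ v ∈ Q, eval v G ≠ 0)
    (hpts : ∀ v ∈ Q, ∃ p : ℕ → Fin n ⊕ Fin n → ℂ,
      (∀ᶠ m : ℕ in atTop, p m ∈ S ∧ p m ∈ expGraph ℂ n) ∧
      (∃ C : ℝ, ∀ᶠ m : ℕ in atTop, ‖(fun i => p m (c i)) - fun i => (m : ℂ) * v i‖ ≤ C * Real.log m) ∧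
      (∀ᶠ m : ℕ in atTop, p m β ≠ 0) ∧
      Tendsto (fun m : ℕ => Real.log ‖p m β‖ / Real.log m) atTop atTop) :
    UnprojectedDense S := by
  refine unprojectedDense_of_no_relation hS hdim (Fin.cons β c) fun H hH0 => ?_
  by_contra hcon
  push Not at hcon
  apply hH0
  refine eq_zero_of_directional_explosion H hQ fun v hv => ?_
  obtain ⟨p, hpS, ⟨C, hC⟩, hβ0, hgr⟩ := hpts v hv
  refine ⟨fun m i => p m (c i), fun m => p m β, eventually_le_mul_of_le_log hC, hβ0, hgr, ?_⟩
  filter_upwards [hpS] with m hm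
  rw [← comp_fin_cons]
  exact hcon (p m) hm

end Density

end Summit.Schanuel.Schanuel.Theorems

end
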